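import Mathlib
import HarnessLib
import Summits.HubbardSuperconductivity.HubbardSuperconductivity.Theorems.KLProgrammeC4aPartnerBandTangencyDefectAll
import Summits.HubbardSuperconductivity.HubbardSuperconductivity.Theorems.KLProgrammeC4aPathRigidity

/-!
# Route `KLProgramme` — crux C4a, S3 brick (B2, TANGENCY, ORDERS ≤ 4, ph twin): the co-moving jets of the ph partner band near its
# `2k_F` configuration `(ρ, ϑ) = (0, π)` at every order `k ≤ 4`, modulo radial rows

Cell `gate-hubbard-kl`, seat hubbard-kl-k3c3-p3 (g23; row «implicit-function / monotonicity route»).  Located brick «(B2)-TAN-ALL», ph half of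
`…C4aPartnerBandTangencyDefectAll`, for the (C)-closer lane hubbard-kl-c4a-1 (stub (C) `stub_twoLeg_curvature` of `KLRegimeEngineV17F2`,
stmt-HubbardSuperconductivity-20437; memo HOME/hubbard-kl-c4a-1/C4A-PLAN.md §24.8 (iii) «The ph loop has the same two configurations … all (B2)
statements exist in both flavours», §24.9).  With `T^ph_k(ρ,ϑ,e) := ∂ᵏ_t|₀ e_K(Φ(e, φ+θ+t) − D_{ρ,ϑ,θ}(t))` (the core `T^ph_k(0,π,0)` is
`abs_iteratedDeriv_partnerBand_ph_tangency_core_le` of the pp/ph file):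

* **`abs_iteratedDeriv_partnerBand_ph_sub_level_le`** — `|T^ph_k(ρ,ϑ,e) − T^ph_k(ρ,ϑ,0)| ≤ |e|·(k+1)!·𝒦·D₁^{k+1}` (radial rows `i ≤ k+1`);
* **`abs_iteratedDeriv_partnerBand_ph_sub_config_le`** — `|T^ph_k(ρ,ϑ,0) − T^ph_k(0,π,0)| ≤ (|ρ| + |ϑ − π|)·(k+1)!·𝒦·D₂^{k+1}` (the perturbation
  `D_{0,π,θ} − D_{ρ,ϑ,θ} = S_{ρ,ϑ,θ}` is the pair-SUM path, small near `(0, π)` by `Φ(0, α+π) = −Φ(0, α)`);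
* **`abs_iteratedDeriv_partnerBand_ph_tangency_le_of_order`** — core + the two reductions, every `k ≤ 4`.

All by the all-orders jet comparison `abs_iteratedDeriv_comp_add_smul_sub_le`; binder shape = `…C4aPathJetsSix`.  Proved bookkeeping on landed
objects; nothing about the Hubbard model's sizes; nothing asserts superconductivity.
References: FST II CPAM 51 (1998) §3; BGM 2006 §2.4 Lemma 2.1 (2.40) [cite: BenfattoGiulianiMastropietro2006].
-/

noncomputable section

namespace Summit.HubbardSuperconductivity.HubbardSuperconductivity.Theorems.C4a

set_option linter.dupNamespace false -- summit = problem name (single-conjunct summit), D-0017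

open Real Set Filter
open scoped Topology
open Literature.MathematicalPhysics.QuantumLattice Literature.MathematicalPhysics.QuantumLattice.BandSectorCounting Literature.Probability.LatticeModels
open Summit.HubbardSuperconductivity.HubbardSuperconductivity.Theorems.KLRegimeSplit
open Summit.HubbardSuperconductivity.HubbardSuperconductivity.Theorems.DispersionFlow
open Summit.HubbardSuperconductivity.HubbardSuperconductivity.Theorems.PerturbedFermiCurve

section Sizes

variable {K : TrigPolyC4v} {A : ℝ} (hA : ∀ p : Momentum, ∀ j ≤ 2, ‖iteratedFDeriv ℝ j (frameShift K) p‖ ≤ A) (hA20 : A ≤ 1 / 20)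
  (hd : klCurveD ≤ (bandBounds (show (-4 : ℝ) < -1.1 by norm_num) (show (-1.1 : ℝ) ≤ -0.1 by norm_num)
    (show (-0.1 : ℝ) < 0 by norm_num)).Dtmin - 2 * A)
  {μ r : ℝ} (hr : 0 < r) (hlo : (-1.1 : ℝ) < μ - r - A) (hhi : μ + r + A < -0.1)
  {A₃ A₄ A₅ A₆ : ℝ} (hA₃ : ∀ p : Momentum, ‖iteratedFDeriv ℝ 3 (frameShift K) p‖ ≤ A₃)
  (hA₄ : ∀ p : Momentum, ‖iteratedFDeriv ℝ 4 (frameShift K) p‖ ≤ A₄)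
  (hA₅ : ∀ p : Momentum, ‖iteratedFDeriv ℝ 5 (frameShift K) p‖ ≤ A₅)
  (hA₆ : ∀ p : Momentum, ‖iteratedFDeriv ℝ 6 (frameShift K) p‖ ≤ A₆)
include hA hA20 hd hr hlo hhi hA₃ hA₄ hA₅ hA₆

omit hA20 hA₃ hA₄ hA₅ hA₆ in
/-- Jets at `t = 0` of the ph comparison path `X(t) = Φ(x, φ+θ+t) − D_{ρ,ϑ,θ}(t)` are the curve jets. -/
theorem iteratedDeriv_levelPoint_sub_pairDiffPath_zero {ρ x : ℝ} (hρ : |ρ| < r) (hx : |x| < r) (ϑ θ φ : ℝ) (j : ℕ) :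
    iteratedDeriv j (fun t : ℝ => levelPoint μ K x (φ + θ + t) - pairDiffPath μ K ρ ϑ θ t) 0 =
      iteratedDeriv j (levelPoint μ K x) (φ + θ) - (iteratedDeriv j (levelPoint μ K 0) θ - iteratedDeriv j (levelPoint μ K ρ) (ϑ + θ)) := by
  set B₀ := bandBounds (show (-4 : ℝ) < -1.1 by norm_num) (show (-1.1 : ℝ) ≤ -0.1 by norm_num) (show (-0.1 : ℝ) < 0 by norm_num) with hB₀
  have hADt : 2 * A < B₀.Dtmin := by have := klCurveD_pos; linarith
  have hD : ContDiff ℝ j (pairDiffPath μ K ρ ϑ θ) := contDiff_pairDiffPath B₀ hA hADt hr hlo hhi hρ ϑ θ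
  have hγ : ContDiff ℝ j (fun t : ℝ => levelPoint μ K x (φ + θ + t)) :=
    (contDiff_levelPoint_of_sizes hA hd hlo hhi hx j).comp (contDiff_const.add contDiff_id)
  rw [iteratedDeriv_fun_sub hγ.contDiffAt hD.contDiffAt, iteratedDeriv_pairDiffPath_zero hA hd hr hlo hhi hρ ϑ θ j,
    iteratedDeriv_comp_const_add (f := levelPoint μ K x)]
  simp only [add_zero]

/-- **REDUCTION `e → 0` AT ORDER `k ≤ 4` (ph)**: given radial rows `‖Φ_e⁽ⁱ⁾ − Φ_0⁽ⁱ⁾‖ ≤ RRᵢ·|e|` for `i ≤ k+1` and a base `D` with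
`3·msD6 i + |e|·RRᵢ + i·RRᵢ₋₁ ≤ Dⁱ` (`1 ≤ i ≤ k+1`):  `|T^ph_k(ρ,ϑ,e) − T^ph_k(ρ,ϑ,0)| ≤ |e|·(k+1)!·𝒦·D^{k+1}`. -/
theorem abs_iteratedDeriv_partnerBand_ph_sub_level_le {k : ℕ} (hk : k ≤ 4) {𝒦 : ℝ}
    (hK : ∀ i, 1 ≤ i → i ≤ k + 1 → ∀ p : Momentum, ‖iteratedFDeriv ℝ i (frameLevel μ K) p‖ ≤ 𝒦)
    {ρ : ℝ} (hρ : |ρ| < r) {e : ℝ} (he : |e| < r) {RR : ℕ → ℝ}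
    (hRR : ∀ i, i ≤ k + 1 → ∀ s, ‖iteratedDeriv i (levelPoint μ K e) s - iteratedDeriv i (levelPoint μ K 0) s‖ ≤ RR i * |e|)
    {D : ℝ} (hDrow : ∀ i, 1 ≤ i → i ≤ k + 1 → 3 * msD6 A₃ A₄ A₅ A₆ i + |e| * RR i + i * RR (i - 1) ≤ D ^ i) (ϑ θ φ : ℝ) :
    |iteratedDeriv k (fun t : ℝ => frameLevel μ K (levelPoint μ K e (φ + θ + t) - pairDiffPath μ K ρ ϑ θ t)) 0 -
      iteratedDeriv k (fun t : ℝ => frameLevel μ K (levelPoint μ K 0 (φ + θ + t) - pairDiffPath μ K ρ ϑ θ t)) 0| ≤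
      |e| * ((k + 1).factorial * 𝒦 * D ^ (k + 1)) := by
  set B₀ := bandBounds (show (-4 : ℝ) < -1.1 by norm_num) (show (-1.1 : ℝ) ≤ -0.1 by norm_num) (show (-0.1 : ℝ) < 0 by norm_num) with hB₀
  have hADt : 2 * A < B₀.Dtmin := by have := klCurveD_pos; linarith
  have h0 : |(0 : ℝ)| < r := by simpa using hr
  by_cases he0 : e = 0
  · subst he0; simp
  set X : ℝ → Momentum := fun t => levelPoint μ K 0 (φ + θ + t) - pairDiffPath μ K ρ ϑ θ t with hX
  set G : ℝ → Momentum := fun t => levelPoint μ K e (φ + θ + t) - levelPoint μ K 0 (φ + θ + t) with hG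
  set Δ : ℝ → Momentum := e⁻¹ • G with hΔ
  have hXc : ContDiff ℝ (k + 1 : ℕ) X := ((contDiff_levelPoint_of_sizes hA hd hlo hhi h0 (k + 1)).comp (contDiff_const.add contDiff_id)).sub
    (contDiff_pairDiffPath B₀ hA hADt hr hlo hhi hρ ϑ θ)
  have hGc : ContDiff ℝ (k + 1 : ℕ) G := ((contDiff_levelPoint_of_sizes hA hd hlo hhi he (k + 1)).comp (contDiff_const.add contDiff_id)).sub
    ((contDiff_levelPoint_of_sizes hA hd hlo hhi h0 (k + 1)).comp (contDiff_const.add contDiff_id))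
  have hΔc : ContDiff ℝ (k + 1 : ℕ) Δ := hGc.const_smul e⁻¹
  have hfun : (fun t : ℝ => frameLevel μ K (levelPoint μ K e (φ + θ + t) - pairDiffPath μ K ρ ϑ θ t)) =
      fun t : ℝ => frameLevel μ K (X t + e • Δ t) := by
    funext t
    simp only [hX, hG, hΔ, Pi.smul_apply, smul_smul, mul_inv_cancel₀ he0, one_smul]
    congr 1; abel
  have hfun0 : (fun t : ℝ => frameLevel μ K (levelPoint μ K 0 (φ + θ + t) - pairDiffPath μ K ρ ϑ θ t)) =
      fun t : ℝ => frameLevel μ K (X t) := rfl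
  rw [hfun, hfun0]
  refine abs_iteratedDeriv_comp_add_smul_sub_le (EngineV8.contDiff_frameLevel μ K (n := (k + 1 : ℕ))) le_rfl hK hXc hΔc e
    (fun i hi1 hi => le_trans ?_ (hDrow i hi1 hi))
  have hXj : ‖iteratedDeriv i X 0‖ ≤ 3 * msD6 A₃ A₄ A₅ A₆ i := by
    rw [hX, iteratedDeriv_levelPoint_sub_pairDiffPath_zero hA hd hr hlo hhi hρ h0 ϑ θ φ i]
    have h1 := norm_iteratedDeriv_levelPoint_le_six hA hA20 hd hlo hhi hA₃ hA₄ hA₅ hA₆ h0 hi1 (by omega) θ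
    have h2 := norm_iteratedDeriv_levelPoint_le_six hA hA20 hd hlo hhi hA₃ hA₄ hA₅ hA₆ hρ hi1 (by omega) (ϑ + θ)
    have h3 := norm_iteratedDeriv_levelPoint_le_six hA hA20 hd hlo hhi hA₃ hA₄ hA₅ hA₆ h0 hi1 (by omega) (φ + θ)
    have := norm_sub_le (iteratedDeriv i (levelPoint μ K 0) (φ + θ)) (iteratedDeriv i (levelPoint μ K 0) θ - iteratedDeriv i (levelPoint μ K ρ) (ϑ + θ))
    have := norm_sub_le (iteratedDeriv i (levelPoint μ K 0) θ) (iteratedDeriv i (levelPoint μ K ρ) (ϑ + θ))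
    linarith
  have hΔj : ∀ j, j ≤ k + 1 → ‖iteratedDeriv j Δ 0‖ ≤ RR j := fun j hj => by
    have hGj : ContDiffAt ℝ j G 0 := (hGc.of_le (by exact_mod_cast hj)).contDiffAt
    rw [hΔ, iteratedDeriv_const_smul hGj, hG, iteratedDeriv_levelPoint_sub_levelPoint_shift_zero hA hd hlo hhi he h0 (φ + θ) j,
      norm_smul, norm_inv, Real.norm_eq_abs]
    have h := hRR j hj (φ + θ)
    have hepos : 0 < |e| := abs_pos.2 he0
    rw [inv_mul_le_iff₀ hepos, mul_comm]
    exact h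
  have t1 := hΔj i hi
  have t2 := hΔj (i - 1) (by omega)
  have hi0 : (0 : ℝ) ≤ i := Nat.cast_nonneg i
  nlinarith [abs_nonneg e, mul_le_mul_of_nonneg_left t1 (abs_nonneg e), mul_le_mul_of_nonneg_left t2 hi0]

/-- **REDUCTION `(ρ, ϑ) → (0, π)` AT ORDER `k ≤ 4` (ph, loop on the Fermi curve)**: given nonnegative radial rows `‖Φ_ρ⁽ⁱ⁾ − Φ_0⁽ⁱ⁾‖ ≤ RRᵢ·|ρ|`
for `i ≤ k+1` and a base `D` with `3·msD6 i + (|ρ|+|ϑ−π|)·(RRᵢ + msD6 (i+1)) + i·(RRᵢ₋₁ + msD6 i) ≤ Dⁱ` (`1 ≤ i ≤ k+1`):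
`|T^ph_k(ρ,ϑ,0) − T^ph_k(0,π,0)| ≤ (|ρ| + |ϑ − π|)·(k+1)!·𝒦·D^{k+1}`. -/
theorem abs_iteratedDeriv_partnerBand_ph_sub_config_le {k : ℕ} (hk : k ≤ 4) {𝒦 : ℝ}
    (hK : ∀ i, 1 ≤ i → i ≤ k + 1 → ∀ p : Momentum, ‖iteratedFDeriv ℝ i (frameLevel μ K) p‖ ≤ 𝒦)
    {ρ : ℝ} (hρ : |ρ| < r) {RR : ℕ → ℝ} (hRR0 : ∀ i, i ≤ k + 1 → 0 ≤ RR i)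
    (hRR : ∀ i, i ≤ k + 1 → ∀ s, ‖iteratedDeriv i (levelPoint μ K ρ) s - iteratedDeriv i (levelPoint μ K 0) s‖ ≤ RR i * |ρ|)
    (ϑ : ℝ) {D : ℝ} (hDrow : ∀ i, 1 ≤ i → i ≤ k + 1 →
      3 * msD6 A₃ A₄ A₅ A₆ i + (|ρ| + |ϑ - π|) * (RR i + msD6 A₃ A₄ A₅ A₆ (i + 1)) + i * (RR (i - 1) + msD6 A₃ A₄ A₅ A₆ i) ≤ D ^ i)
    (θ φ : ℝ) :
    |iteratedDeriv k (fun t : ℝ => frameLevel μ K (levelPoint μ K 0 (φ + θ + t) - pairDiffPath μ K ρ ϑ θ t)) 0 -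
      iteratedDeriv k (fun t : ℝ => frameLevel μ K (levelPoint μ K 0 (φ + θ + t) - pairDiffPath μ K 0 π θ t)) 0| ≤
      (|ρ| + |ϑ - π|) * ((k + 1).factorial * 𝒦 * D ^ (k + 1)) := by
  set B₀ := bandBounds (show (-4 : ℝ) < -1.1 by norm_num) (show (-1.1 : ℝ) ≤ -0.1 by norm_num) (show (-0.1 : ℝ) < 0 by norm_num) with hB₀
  have hADt : 2 * A < B₀.Dtmin := by have := klCurveD_pos; linarith
  have h0 : |(0 : ℝ)| < r := by simpa using hr
  set δ : ℝ := |ρ| + |ϑ - π| with hδ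
  have hδ0 : 0 ≤ δ := add_nonneg (abs_nonneg ρ) (abs_nonneg _)
  by_cases hδz : δ = 0
  · have hρ0 : ρ = 0 := abs_eq_zero.1 (by linarith [abs_nonneg ρ, abs_nonneg (ϑ - π)])
    have hϑ0 : ϑ = π := by have h := abs_eq_zero.1 (show |ϑ - π| = 0 by linarith [abs_nonneg ρ, abs_nonneg (ϑ - π)]); linarith
    subst hρ0; subst hϑ0
    rw [hδz, sub_self, abs_zero, zero_mul]
  have hδpos : 0 < δ := lt_of_le_of_ne hδ0 (Ne.symm hδz)
  set X : ℝ → Momentum := fun t => levelPoint μ K 0 (φ + θ + t) - pairDiffPath μ K 0 π θ t with hX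
  set G : ℝ → Momentum := pairSumPath μ K ρ ϑ θ with hG
  set Δ : ℝ → Momentum := δ⁻¹ • G with hΔ
  have hXc : ContDiff ℝ (k + 1 : ℕ) X := ((contDiff_levelPoint_of_sizes hA hd hlo hhi h0 (k + 1)).comp (contDiff_const.add contDiff_id)).sub
    (contDiff_pairDiffPath B₀ hA hADt hr hlo hhi h0 π θ)
  have hGc : ContDiff ℝ (k + 1 : ℕ) G := contDiff_pairSumPath B₀ hA hADt hr hlo hhi hρ ϑ θ
  have hΔc : ContDiff ℝ (k + 1 : ℕ) Δ := hGc.const_smul δ⁻¹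
  have hfun : (fun t : ℝ => frameLevel μ K (levelPoint μ K 0 (φ + θ + t) - pairDiffPath μ K ρ ϑ θ t)) =
      fun t : ℝ => frameLevel μ K (X t + δ • Δ t) := by
    funext t
    have hs := pairDiffPath_pi_sub_eq_pairSumPath μ K ρ ϑ θ t
    simp only [hX, hG, hΔ, Pi.smul_apply, smul_smul, mul_inv_cancel₀ hδz, one_smul]
    rw [← hs]
    congr 1; abel
  have hfun0 : (fun t : ℝ => frameLevel μ K (levelPoint μ K 0 (φ + θ + t) - pairDiffPath μ K 0 π θ t)) =
      fun t : ℝ => frameLevel μ K (X t) := rfl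
  rw [hfun, hfun0]
  have hcmp := abs_iteratedDeriv_comp_add_smul_sub_le (EngineV8.contDiff_frameLevel μ K (n := (k + 1 : ℕ))) le_rfl hK hXc hΔc δ
    (D := D) (fun i hi1 hi => le_trans ?_ (hDrow i hi1 hi))
  · rwa [abs_of_nonneg hδ0] at hcmp
  have hXj : ‖iteratedDeriv i X 0‖ ≤ 3 * msD6 A₃ A₄ A₅ A₆ i := by
    rw [hX, iteratedDeriv_levelPoint_sub_pairDiffPath_zero hA hd hr hlo hhi h0 h0 π θ φ i]
    have h1 := norm_iteratedDeriv_levelPoint_le_six hA hA20 hd hlo hhi hA₃ hA₄ hA₅ hA₆ h0 hi1 (by omega) θ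
    have h2 := norm_iteratedDeriv_levelPoint_le_six hA hA20 hd hlo hhi hA₃ hA₄ hA₅ hA₆ h0 hi1 (by omega) (π + θ)
    have h3 := norm_iteratedDeriv_levelPoint_le_six hA hA20 hd hlo hhi hA₃ hA₄ hA₅ hA₆ h0 hi1 (by omega) (φ + θ)
    have := norm_sub_le (iteratedDeriv i (levelPoint μ K 0) (φ + θ)) (iteratedDeriv i (levelPoint μ K 0) θ - iteratedDeriv i (levelPoint μ K 0) (π + θ))
    have := norm_sub_le (iteratedDeriv i (levelPoint μ K 0) θ) (iteratedDeriv i (levelPoint μ K 0) (π + θ))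
    linarith
  -- `‖S⁽ʲ⁾(0)‖ = ‖Φ_ρ⁽ʲ⁾(ϑ+θ) − Φ_0⁽ʲ⁾(π+θ)‖ ≤ RRⱼ|ρ| + msD6 (j+1)|ϑ − π|`
  have hGj : ∀ j, j ≤ k + 1 → ‖iteratedDeriv j G 0‖ ≤ RR j * |ρ| + msD6 A₃ A₄ A₅ A₆ (j + 1) * |ϑ - π| := fun j hj => by
    rw [hG, iteratedDeriv_pairSumPath_zero hA hd hr hlo hhi hρ ϑ θ j]
    have e1 : iteratedDeriv j (levelPoint μ K 0) θ + iteratedDeriv j (levelPoint μ K ρ) (ϑ + θ) =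
        (iteratedDeriv j (levelPoint μ K ρ) (ϑ + θ) - iteratedDeriv j (levelPoint μ K 0) (ϑ + θ)) +
        (iteratedDeriv j (levelPoint μ K 0) (ϑ + θ) - iteratedDeriv j (levelPoint μ K 0) (θ + π)) := by
      rw [iteratedDeriv_levelPoint_add_pi]; abel
    rw [e1]
    refine (norm_add_le _ _).trans (add_le_add (hRR j hj (ϑ + θ)) ?_)
    have h := norm_iteratedDeriv_levelPoint_sub_le_angle_six hA hA20 hd hlo hhi hA₃ hA₄ hA₅ hA₆ h0 (by omega : j ≤ 5) (ϑ + θ) (θ + π)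
    rwa [show ϑ + θ - (θ + π) = ϑ - π by ring] at h
  have hΔj : ∀ j, j ≤ k + 1 → ‖iteratedDeriv j Δ 0‖ ≤ RR j + msD6 A₃ A₄ A₅ A₆ (j + 1) := fun j hj => by
    have hGjc : ContDiffAt ℝ j G 0 := (hGc.of_le (by exact_mod_cast hj)).contDiffAt
    rw [hΔ, iteratedDeriv_const_smul hGjc, norm_smul, norm_inv, Real.norm_eq_abs, abs_of_pos hδpos, inv_mul_le_iff₀ hδpos]
    refine (hGj j hj).trans ?_
    have hM : 0 ≤ msD6 A₃ A₄ A₅ A₆ (j + 1) := msD6_nonneg hA hA20 hd hlo hhi hA₃ hA₄ hA₅ hA₆ (by omega) (by omega) h0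
    have hR := hRR0 j hj
    rw [hδ]
    nlinarith [abs_nonneg ρ, abs_nonneg (ϑ - π)]
  have t1 := hΔj i hi
  have t2 := hΔj (i - 1) (by omega)
  have hi0 : (0 : ℝ) ≤ i := Nat.cast_nonneg i
  have hsub : (i - 1 + 1 : ℕ) = i := by omega
  rw [hsub] at t2
  rw [abs_of_nonneg hδ0]
  nlinarith [mul_le_mul_of_nonneg_left t1 hδ0, mul_le_mul_of_nonneg_left t2 hi0]

/-- **THE `k`-TH CO-MOVING JET OF THE ph PARTNER BAND NEAR `2k_F`, `k ≤ 4`** — core + the two reductions: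
`|T^ph_k(ρ,ϑ,e)| ≤ (k+2)!·𝒦·(3𝒟)^{k+2}·φ² + |e|·(k+1)!·𝒦·D₁^{k+1} + (|ρ|+|ϑ−π|)·(k+1)!·𝒦·D₂^{k+1}`, modulo the radial rows `RRᵢ` (`i ≤ k+1`). -/
theorem abs_iteratedDeriv_partnerBand_ph_tangency_le_of_order {k : ℕ} (hk : k ≤ 4) {𝒦 𝒟 : ℝ}
    (hK : ∀ i, 1 ≤ i → i ≤ k + 2 → ∀ p : Momentum, ‖iteratedFDeriv ℝ i (frameLevel μ K) p‖ ≤ 𝒦)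
    (hD : ∀ i, 1 ≤ i → i ≤ k + 2 → msD6 A₃ A₄ A₅ A₆ i ≤ 𝒟 ^ i)
    {ρ : ℝ} (hρ : |ρ| < r) {e : ℝ} (he : |e| < r) {RR : ℕ → ℝ} (hRR0 : ∀ i, i ≤ k + 1 → 0 ≤ RR i)
    (hRRe : ∀ i, i ≤ k + 1 → ∀ s, ‖iteratedDeriv i (levelPoint μ K e) s - iteratedDeriv i (levelPoint μ K 0) s‖ ≤ RR i * |e|)
    (hRRρ : ∀ i, i ≤ k + 1 → ∀ s, ‖iteratedDeriv i (levelPoint μ K ρ) s - iteratedDeriv i (levelPoint μ K 0) s‖ ≤ RR i * |ρ|)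
    (ϑ : ℝ) {D₁ D₂ : ℝ} (hD₁ : ∀ i, 1 ≤ i → i ≤ k + 1 → 3 * msD6 A₃ A₄ A₅ A₆ i + |e| * RR i + i * RR (i - 1) ≤ D₁ ^ i)
    (hD₂ : ∀ i, 1 ≤ i → i ≤ k + 1 →
      3 * msD6 A₃ A₄ A₅ A₆ i + (|ρ| + |ϑ - π|) * (RR i + msD6 A₃ A₄ A₅ A₆ (i + 1)) + i * (RR (i - 1) + msD6 A₃ A₄ A₅ A₆ i) ≤ D₂ ^ i)
    (θ φ : ℝ) :
    |iteratedDeriv k (fun t : ℝ => frameLevel μ K (levelPoint μ K e (φ + θ + t) - pairDiffPath μ K ρ ϑ θ t)) 0| ≤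
      (k + 2).factorial * 𝒦 * (3 * 𝒟) ^ (k + 2) * φ ^ 2 + |e| * ((k + 1).factorial * 𝒦 * D₁ ^ (k + 1)) +
        (|ρ| + |ϑ - π|) * ((k + 1).factorial * 𝒦 * D₂ ^ (k + 1)) := by
  have hK1 : ∀ i, 1 ≤ i → i ≤ k + 1 → ∀ p : Momentum, ‖iteratedFDeriv ℝ i (frameLevel μ K) p‖ ≤ 𝒦 := fun i hi1 hi p => hK i hi1 (by omega) p
  have step1 := abs_iteratedDeriv_partnerBand_ph_sub_level_le hA hA20 hd hr hlo hhi hA₃ hA₄ hA₅ hA₆ hk hK1 hρ he hRRe hD₁ ϑ θ φ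
  have step2 := abs_iteratedDeriv_partnerBand_ph_sub_config_le hA hA20 hd hr hlo hhi hA₃ hA₄ hA₅ hA₆ hk hK1 hρ hRR0 hRRρ ϑ hD₂ θ φ
  have step3 := abs_iteratedDeriv_partnerBand_ph_tangency_core_le hA hA20 hd hr hlo hhi hA₃ hA₄ hA₅ hA₆ hk hK hD θ φ
  have tri := abs_sub_abs_le_abs_sub (iteratedDeriv k (fun t : ℝ => frameLevel μ K (levelPoint μ K e (φ + θ + t) - pairDiffPath μ K ρ ϑ θ t)) 0)
    (iteratedDeriv k (fun t : ℝ => frameLevel μ K (levelPoint μ K 0 (φ + θ + t) - pairDiffPath μ K ρ ϑ θ t)) 0)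
  have tri' := abs_sub_abs_le_abs_sub (iteratedDeriv k (fun t : ℝ => frameLevel μ K (levelPoint μ K 0 (φ + θ + t) - pairDiffPath μ K ρ ϑ θ t)) 0)
    (iteratedDeriv k (fun t : ℝ => frameLevel μ K (levelPoint μ K 0 (φ + θ + t) - pairDiffPath μ K 0 π θ t)) 0)
  linarith

end Sizes

end Summit.HubbardSuperconductivity.HubbardSuperconductivity.Theorems.C4a

end
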